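import Summits.ResolutionOfSingularities.ResolutionOfSingularities.Theorems.HomologicalConductorNoZenoGWH2ResolutionHolds
import Summits.ResolutionOfSingularities.ResolutionOfSingularities.Theorems.HomologicalConductorNoZenoRLipman131Rational
import Literature.AlgebraicGeometry.Resolution.RationalResolutionH0InclusionExclusion
import Literature.AlgebraicGeometry.Resolution.ExceptionalFibreConnected
import Literature.AlgebraicGeometry.Morphisms.CechModuleBiproduct
import Literature.AlgebraicGeometry.Morphisms.FormalModuleAffine
import HarnessLib

/-!
# Crux `NoZenoR` (stmt-ResolutionOfSingularities-19943) — toward Lipman 1969, Proposition (3.1): `H¹(𝔪𝒪_X) = 0` and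
# `h⁰(𝒪_X/𝔪𝒪_X) ≤ 1` on a desingularization of a rational surface singularity

Route `ResolutionOfSingularities/HomologicalConductor` (cell decomp-res, hand leafhand-res-homologicalconduct-21 g0).
OURS: AI-written proof over tree theorems, weaker than expert review; nothing here is a statement of the manuscript
under review (Hironaka 2017).  SUPPORT level, counted 0.  Def-free, FACT-FREE (no named Literature fact is assumed).

This is the cohomological half of Lipman's proof of Proposition (3.1) (pp. 203–204: "since `𝓜 = 𝔪𝒪_X`, we have an
exact sequence `0 → 𝒦 → 𝒪_X^n → 𝓜 → 0` …  The fibres of `f` are of dimension `≤ 1`, so `R²f_*(𝒦) = 0` [EGA III,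
(4.2.2)], i.e. `H²(𝒦) = 0`.  By hypothesis `H¹(𝒪_X^n) = 0`.  Hence `H¹(𝓜) = 0`, and therefore
`Γ(𝒪_X/𝓜) = Γ(𝒪_X)/Γ(𝓜)`.  But clearly `𝔪 ⊆ Γ(𝓜) ⊊ Γ(𝒪_X) = R` so that, indeed, `Γ(𝒪_X/𝓜) = R/𝔪`"), consumed by
`…Theorems.HomologicalConductorNoZenoRQuadraticTransformDominated` (Prop. (3.1) itself: `𝔪𝒪_X` is invertible):

* §1 `subsingleton_cechMH1_idealMul_span` — **`Ȟ¹(𝒰, (t₁,…,tₙ)𝒪_X) = 0`** for an ideal sheaf generated by finitely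
  many global functions (`ofIdealTop (span t)`) on a separated locally Noetherian `A`-scheme with `Ȟ¹(𝒰, 𝒪_X) = 0`
  and `Ȟ² = 0` on affine-localizing modules: the presentation `𝒪_X^n ↠ (t)𝒪_X` (`eᵢ ↦ tᵢ`, onto on affine
  opens because `Γ(V, 𝓘𝒪_X) = 𝓘(V)`, tree `Modules/IdealMul`) has affine-localizing kernel, and `Ȟ¹` is right exact
  where `Ȟ² = 0` (tree `Morphisms/CechModuleBiproduct.subsingleton_cechMH1_of_shortExact_of_iso_free_of_isSeparated`).
* §2 `h0_baseIdeal_maximalIdeal_le_one` — **`h⁰(𝒪_X/𝔪𝒪_X) ≤ 1`** for a desingularization `π : X → Spec S` of a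
  two-dimensional normal Noetherian local domain with a rational singularity (`𝔪𝒪_X = ofIdealTop (𝔪·Γ(X, 𝒪_X))`, the
  base ideal sheaf of `…NoZenoBaseIdealCartier`): §1 applies with `Ȟ¹(𝒪_X) = 0` from rationality
  (`Lipman12B.hasTrivialCechH1_of_isResolution_of_hasRationalSingularity`, a tree theorem over Lipman (1.2) B)) and
  `Ȟ² = 0` at resolutions (`gwH2ResolutionDim2_holds`, Görtz–Wedhorn II 24.44 at resolutions, a tree theorem), so
  `Γ(𝒪_X) → Γ(𝒪_X/𝔪𝒪_X)` is onto (`app_top_surjective_of_shortExact_of_subsingleton_cechMH1`); as `Γ(𝒪_X) = S`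
  (`IsResolution.isIso_appTop`) and the image is killed by `𝔪`, `Γ(𝒪_X/𝔪𝒪_X)` is a quotient of the simple
  `S`-module `S/𝔪`, and `h0 = length_S Γ(𝒪_X/𝔪𝒪_X)` (`h0_eq_length_MSections_idealQuot`) is `≤ 1`.

No crux, kill test or summit statement is proved here; resolution in positive characteristic is NOT proved.

References: J. Lipman, Publ. Math. IHÉS 36 (1969), Proposition (3.1) and its proof (pp. 203–204) [`Lipman1969`];
R. Hartshorne, *Algebraic Geometry* (1977), III Thm. 4.5 (proof, p. 222) [`Hartshorne1977`]; U. Görtz, T. Wedhorn,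
*Algebraic Geometry I* (2020), Prop. 7.14 [`GortzWedhorn2020`]; The Stacks Project, Tag 01ED [`StacksProject`].
-/

noncomputable section

-- single-problem summit: the doubled namespace component `ResolutionOfSingularities` is forced
set_option linter.dupNamespace false
-- `TopCat.Presheaf`/`Scheme.Modules` are not reducible (as in Mathlib's `AlgebraicGeometry/Modules`).
set_option backward.isDefEq.respectTransparency false

open CategoryTheory CategoryTheory.Limits AlgebraicGeometry TopologicalSpace Opposite IsLocalRing
open Literature.AlgebraicGeometry.Morphisms Literature.AlgebraicGeometry.Modules
open Literature.AlgebraicGeometry.Resolution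
open Literature.AlgebraicGeometry.Motives (Scheme.Modules.Hom.app_map_apply)

namespace Summit.ResolutionOfSingularities.ResolutionOfSingularities.Theorems.NoZeno.QuadraticTransform

universe u

/-! ## §1 `Ȟ¹(𝒰, 𝓘𝒪_X) = 0` for an ideal sheaf generated by finitely many global functions -/

section GlobalGenerators

variable {X : Scheme.{u}} {n : ℕ} (t : Fin n → Γ(X, ⊤))

/-- A global function lying in `I ⊆ Γ(X, 𝒪_X)` is a product section of `(ofIdealTop I)·𝒪_X` over `⊤`. [folklore] -/
theorem isIdealMulSection_top_of_mem {I : Ideal Γ(X, ⊤)} {s : Γ(X, ⊤)} (hs : s ∈ I) :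
    IsIdealMulSection (unitModule X) (Scheme.IdealSheafData.ofIdealTop I) ⊤
      (show Γ(unitModule X, ⊤) from s) := by
  intro x _
  obtain ⟨V, hV, hxV, -⟩ := Opens.isBasis_iff_nbhd.mp X.isBasis_affineOpens (Opens.mem_top x)
  refine ⟨⟨V, hV⟩, le_top, hxV, ?_⟩
  rw [mem_ideal_smul_top_unitModule_iff]
  change X.presheaf.map (homOfLE (le_top : V ≤ ⊤)).op s ∈ (Scheme.IdealSheafData.ofIdealTop I).ideal ⟨V, hV⟩
  rw [Scheme.IdealSheafData.ofIdealTop_ideal]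
  exact Ideal.mem_map_of_mem _ hs

/-- **`Ȟ¹(𝒰, (t₁,…,tₙ)·𝒪_X) = 0`** on a separated locally Noetherian `A`-scheme `f : X → Spec A` with
`Ȟ¹(𝒰, 𝒪_X) = 0` and `Ȟ²(𝒰, 𝒦) = 0` for every affine-localizing `𝒦` (finite affine open cover `𝒰`): the ideal
sheaf `(t)𝒪_X = ofIdealTop (span t)` is a quotient of `𝒪_X^n` — the presentation `eᵢ ↦ tᵢ` is onto over every
affine open `V`, where `Γ(V, (t)𝒪_X) = (t|_V)·Γ(V, 𝒪_X)` — with affine-localizing kernel, and `Ȟ¹` is right exact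
where `Ȟ² = 0`.  (Lipman 1969, proof of Prop. (3.1), p. 204: "`0 → 𝒦 → 𝒪_X^n → 𝓜 → 0` … `H²(𝒦) = 0` …
`H¹(𝒪_X^n) = 0`.  Hence `H¹(𝓜) = 0`.") [cite: Lipman1969, Proposition (3.1), proof (p. 204)]
[cite: Hartshorne1977, III proof of Thm. 4.5 (p. 222)] -/
theorem subsingleton_cechMH1_idealMul_span {A : Type u} [CommRing A] (f : X ⟶ Spec (.of A))
    [X.IsSeparated] [IsLocallyNoetherian X] {ι : Type u} (U : ι → X.Opens) (hU : ∀ i, IsAffineOpen (U i))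
    (hO : Subsingleton (CechH1 f U))
    (hH2 : ∀ K : X.Modules, IsAffineLocalizing K → Subsingleton (CechMH2 f K U)) :
    Subsingleton (CechMH1 f
      (idealMul (unitModule X) (Scheme.IdealSheafData.ofIdealTop (Ideal.span (Set.range t)))) U) := by
  classical
  set J := Scheme.IdealSheafData.ofIdealTop (Ideal.span (Set.range t)) with hJ
  -- the global sections `sᵢ` of `(t)𝒪_X` with `ι(sᵢ) = tᵢ`
  have hsec : ∀ i : Fin n, ∃ m : Γ(idealMul (unitModule X) J, ⊤),
      (idealMulι (unitModule X) J).app ⊤ m = (show Γ(unitModule X, ⊤) from t i) := fun i =>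
    exists_idealMulι_app_eq (M := unitModule X) (J := J) (show Γ(unitModule X, ⊤) from t i)
      (isIdealMulSection_top_of_mem (Ideal.subset_span ⟨i, rfl⟩))
  choose s hs using hsec
  -- the presentation `ψ : 𝒪_X^n ⟶ (t)𝒪_X`, `eᵢ ↦ sᵢ`
  let ψ : freeMod X n ⟶ idealMul (unitModule X) J := freeHomOfSections _ s
  have hψe : ∀ (i : Fin n) (V : X.Opens),
      ψ.app V ((SheafOfModules.freeSection (R := X.ringCatSheaf) (ULift.up i)).val (op V)) =
        (idealMul (unitModule X) J).presheaf.map (homOfLE (le_top : V ≤ ⊤)).op (s i) := fun i V => by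
    have h := SheafOfModules.sectionsMap_freeHomEquiv_symm_freeSection (M := idealMul (unitModule X) J)
      (fun i : ULift.{u} (Fin n) => (sectionsEquivTop _).symm (s i.down)) (ULift.up i)
    exact congrArg (fun σ : (idealMul (unitModule X) J).sections => σ.val (op V)) h
  -- `ψ` is onto over affine opens: a section of `(t)𝒪_X` over `V` is a function `∑ aᵢ·tᵢ|_V`
  have hsurj : ∀ V : X.Opens, IsAffineOpen V → Function.Surjective (ψ.app V) := by
    intro V hV y
    have hy : (show Γ(X, V) from (idealMulι (unitModule X) J).app V y) ∈ J.ideal ⟨V, hV⟩ := by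
      have h := idealMulι_app_mem (M := unitModule X) (J := J) IsAffineLocalizing.unit hV y
      rwa [mem_ideal_smul_top_unitModule_iff] at h
    change (show Γ(X, V) from (idealMulι (unitModule X) J).app V y) ∈
      (Scheme.IdealSheafData.ofIdealTop (Ideal.span (Set.range t))).ideal ⟨V, hV⟩ at hy
    rw [Scheme.IdealSheafData.ofIdealTop_ideal, Ideal.map_span, ← Set.range_comp,
      Ideal.mem_span_range_iff_exists_fun] at hy
    obtain ⟨a, ha⟩ := hy
    let e : Fin n → Γ(freeMod X n, V) := fun i =>
      (SheafOfModules.freeSection (R := X.ringCatSheaf) (ULift.up i)).val (op V)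
    refine ⟨∑ i, a i • e i, ?_⟩
    apply idealMulι_app_injective
    rw [map_sum, map_sum]
    change _ = (show Γ(unitModule X, V) from (show Γ(X, V) from (idealMulι (unitModule X) J).app V y))
    rw [← ha]
    refine Finset.sum_congr rfl fun i _ => ?_
    rw [Scheme.Modules.Hom.app_smul, Scheme.Modules.Hom.app_smul, hψe, Scheme.Modules.Hom.app_map_apply, hs]
    rfl
  haveI : Epi ψ := epi_of_surjective_app_of_isAffineOpen _ hsurj
  -- `0 → 𝒦 → 𝒪_X^n → (t)𝒪_X → 0` with `𝒦` affine-localizing, and `Ȟ¹` right exact where `Ȟ² = 0`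
  have hS : (ShortComplex.mk (kernel.ι ψ) ψ (kernel.condition _)).ShortExact :=
    ShortComplex.ShortExact.mk' (ShortComplex.exact_of_f_is_kernel _ (kernelIsKernel _))
      inferInstance inferInstance
  have hK : IsAffineLocalizing (kernel ψ) :=
    IsAffineLocalizing.kernel _ (coh_freeMod (X := X) n).loc
      (isAffineLocalizing_idealMul (M := unitModule X) (J := J) IsAffineLocalizing.unit)
  have e : (freeMod X n : X.Modules) ≅ SheafOfModules.free (R := X.ringCatSheaf) (ULift.{u} (Fin n)) :=
    Iso.refl _
  have key := subsingleton_cechMH1_of_shortExact_of_iso_free_of_isSeparated (I := ULift.{u} (Fin n)) f U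
    hS e hK hU hO (hH2 _ hK)
  convert key using 2

end GlobalGenerators

/-! ## §2 `h⁰(𝒪_X/𝔪𝒪_X) ≤ 1` on a desingularization of a rational surface singularity -/

section LengthBound

variable {S : Type} [CommRing S] [IsNoetherianRing S] [IsLocalRing S] [IsDomain S] [IsIntegrallyClosed S]
  {X : Scheme.{0}} (π : X ⟶ Spec (.of S))

/-- A global section of `𝒪_X/𝓘𝒪_X` coming from a global function in `I` vanishes (`𝓘 = ofIdealTop I`). [folklore] -/
theorem idealQuotπ_app_top_eq_zero_of_mem {I : Ideal Γ(X, ⊤)} {s : Γ(X, ⊤)} (hs : s ∈ I) :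
    (idealQuotπ (unitModule X) (Scheme.IdealSheafData.ofIdealTop I)).app ⊤ (show Γ(unitModule X, ⊤) from s) = 0 := by
  refine section_eq_zero_of_locally _ _ fun x _ => ?_
  obtain ⟨V, hV, hxV, -⟩ := Opens.isBasis_iff_nbhd.mp X.isBasis_affineOpens (Opens.mem_top x)
  refine ⟨V, le_top, hxV, ?_⟩
  rw [← Scheme.Modules.Hom.app_map_apply, idealQuotπ_unit_app_eq_zero_iff _ hV]
  change X.presheaf.map (homOfLE (le_top : V ≤ ⊤)).op s ∈ (Scheme.IdealSheafData.ofIdealTop I).ideal ⟨V, hV⟩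
  rw [Scheme.IdealSheafData.ofIdealTop_ideal]
  exact Ideal.mem_map_of_mem _ hs

omit [IsLocalRing S] in
/-- The structure map `S → Γ(X, 𝒪_X)` of a desingularization of a normal `S` is onto (`Γ(X, 𝒪_X) = S`).
[cite: Lipman1969, Section 1 (p. 199)] -/
theorem algebraMapΓ_surjective_of_isResolution (hπ : IsResolution π) : Function.Surjective (algebraMapΓ π) := by
  haveI := hπ.isIso_appTop
  change Function.Surjective (π.appTop.hom.comp (Scheme.ΓSpecIso (.of S)).inv.hom)
  rw [RingHom.coe_comp]
  exact (ConcreteCategory.bijective_of_isIso (C := CommRingCat) π.appTop).2.comp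
    (ConcreteCategory.bijective_of_isIso (C := CommRingCat) (Scheme.ΓSpecIso (.of S)).inv).2

omit [IsNoetherianRing S] [IsLocalRing S] [IsDomain S] [IsIntegrallyClosed S] in
/-- In `Γ(X, 𝒪_X)` as an `S`-module, `a • 1 = algebraMapΓ π a`. [folklore] -/
theorem smul_one_MSections_unit (a : S) :
    (a • (show MSections π (unitModule X) ⊤ from (1 : Γ(X, ⊤))) : MSections π (unitModule X) ⊤) =
      (show MSections π (unitModule X) ⊤ from algebraMapΓ π a) := by
  rw [← MSections.algebraMap_smul, Sections.algebraMap_apply]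
  have h : (homOfLE (le_top : (⊤ : X.Opens) ≤ ⊤)).op = 𝟙 (op ⊤) := Subsingleton.elim _ _
  rw [h, X.presheaf.map_id]
  exact (mul_one (algebraMapΓ π a) : algebraMapΓ π a * 1 = algebraMapΓ π a)

/-- **`h⁰(𝒪_X/𝔪𝒪_X) ≤ 1`** (Lipman 1969, proof of Prop. (3.1), p. 204: "`Γ(𝒪_X/𝓜) = R/𝔪`"): on a desingularization
`π : X → Spec S` of a two-dimensional normal local domain with a rational singularity, the ring of global sections of
the closed fibre `V(𝔪𝒪_X)` has `S`-length `≤ 1`.  Proof: `𝔪𝒪_X` is a quotient of `𝒪_X^n` (generators of `𝔪`), so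
`H¹(𝔪𝒪_X) = 0` (`H¹(𝒪_X) = 0` by rationality, `H² = 0` on the curve-fibred `X`), whence
`Γ(𝒪_X) = S ↠ Γ(𝒪_X/𝔪𝒪_X)` with kernel `⊇ 𝔪`. [cite: Lipman1969, Proposition (3.1), proof (pp. 203–204)] -/
theorem h0_baseIdeal_maximalIdeal_le_one (hdim : ringKrullDim S = 2) (hrat : HasRationalSingularity S)
    (hπ : IsResolution π) :
    h0 π (Scheme.IdealSheafData.ofIdealTop ((maximalIdeal S).map (algebraMapΓ π))) ≤ 1 := by
  classical
  haveI : IsProper π := hπ.isProper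
  haveI : IsIntegral X := hπ.isIntegral_source
  haveI : IsLocallyNoetherian X := LocallyOfFiniteType.isLocallyNoetherian π
  haveI : X.IsSeparated := ⟨by rw [← terminal.comp_from π]; infer_instance⟩
  haveI : CompactSpace X := QuasiCompact.compactSpace_of_compactSpace π
  -- generators of `𝔪` and the ideal sheaf `𝔪𝒪_X = (t₁, …, tₙ)𝒪_X`
  obtain ⟨n, g, hg⟩ := Submodule.fg_iff_exists_fin_generating_family.mp
    ((isNoetherianRing_iff_ideal_fg S).mp inferInstance (maximalIdeal S))
  let t : Fin n → Γ(X, ⊤) := fun i => algebraMapΓ π (g i)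
  have hJ : Scheme.IdealSheafData.ofIdealTop ((maximalIdeal S).map (algebraMapΓ π)) =
      Scheme.IdealSheafData.ofIdealTop (Ideal.span (Set.range t)) := by
    rw [← hg, Ideal.map_span, ← Set.range_comp]
    rfl
  rw [hJ, h0_eq_length_MSections_idealQuot]
  set J := Scheme.IdealSheafData.ofIdealTop (Ideal.span (Set.range t)) with hJdef
  -- a finite affine open cover
  obtain ⟨𝒮, h𝒮, hcov⟩ := (isCompact_iff_finite_and_eq_biUnion_affineOpens (U := (⊤ : X.Opens))).mp
    (CompactSpace.isCompact_univ (X := X))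
  haveI : Finite 𝒮 := h𝒮.to_subtype
  let U : 𝒮 → X.Opens := fun i => (i.1 : X.Opens)
  have hUaff : ∀ i, IsAffineOpen (U i) := fun i => i.1.2
  have hUcov : ⨆ i, U i = ⊤ := by
    change ⨆ i : 𝒮, ((i.1 : X.affineOpens) : X.Opens) = ⊤
    rw [iSup_subtype'', ← hcov]
  -- `Ȟ¹(𝒰, 𝔪𝒪_X) = 0`
  have hO : Subsingleton (CechH1 π U) :=
    NoZeno.Lipman12B.hasTrivialCechH1_of_isResolution_of_hasRationalSingularity hdim hrat π hπ _ U hUaff hUcov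
  have hH2 : ∀ K : X.Modules, IsAffineLocalizing K → Subsingleton (CechMH2 π K U) := fun K hK =>
    gwH2ResolutionDim2_holds S hdim X π hπ K hK _ U hUaff hUcov
  have h1 : Subsingleton (CechMH1 π (idealMul (unitModule X) J) U) :=
    subsingleton_cechMH1_idealMul_span t π U hUaff hO hH2
  -- `Γ(𝒪_X) ↠ Γ(𝒪_X/𝔪𝒪_X)`
  have hsurj : Function.Surjective ((idealQuotπ (unitModule X) J).app ⊤) :=
    app_top_surjective_of_shortExact_of_subsingleton_cechMH1 π U hUaff hUcov (shortExact_idealMul (unitModule X) J)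
      (isAffineLocalizing_idealMul (M := unitModule X) (J := J) IsAffineLocalizing.unit) h1
  -- the `S`-module `Γ(𝒪_X/𝔪𝒪_X)` is generated by the image `e` of `1`, and killed by `𝔪`
  let q : MSections π (unitModule X) ⊤ →ₗ[S] MSections π (idealQuot (unitModule X) J) ⊤ :=
    MSections.app π (idealQuotπ (unitModule X) J) ⊤
  let e : MSections π (idealQuot (unitModule X) J) ⊤ := q (show MSections π (unitModule X) ⊤ from (1 : Γ(X, ⊤)))
  have hgen : ∀ m : MSections π (idealQuot (unitModule X) J) ⊤, ∃ a : S, a • e = m := by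
    intro m
    obtain ⟨u, hu⟩ := hsurj m
    obtain ⟨a, ha⟩ := algebraMapΓ_surjective_of_isResolution π hπ (show Γ(X, ⊤) from u)
    refine ⟨a, ?_⟩
    rw [← map_smul, smul_one_MSections_unit, ha]
    exact hu
  have hkill : ∀ a ∈ maximalIdeal S, a • e = 0 := by
    intro a ha
    rw [← map_smul, smul_one_MSections_unit]
    change (idealQuotπ (unitModule X) J).app ⊤ (show Γ(unitModule X, ⊤) from algebraMapΓ π a) = 0
    refine idealQuotπ_app_top_eq_zero_of_mem ?_
    have h' : algebraMapΓ π a ∈ (maximalIdeal S).map (algebraMapΓ π) := Ideal.mem_map_of_mem _ ha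
    rw [← hg, Ideal.map_span, ← Set.range_comp] at h'
    exact h'
  -- hence it is a quotient of the simple module `S/𝔪`
  let φ : (S ⧸ maximalIdeal S) →ₗ[S] MSections π (idealQuot (unitModule X) J) ⊤ :=
    Submodule.liftQ (maximalIdeal S) (LinearMap.toSpanSingleton S _ e) fun a ha => by
      rw [LinearMap.mem_ker, LinearMap.toSpanSingleton_apply]
      exact hkill a ha
  have hφ : Function.Surjective φ := by
    intro m
    obtain ⟨a, ha⟩ := hgen m
    exact ⟨Submodule.Quotient.mk a, by rw [Submodule.liftQ_apply, LinearMap.toSpanSingleton_apply, ha]⟩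
  haveI : IsSimpleModule S (S ⧸ maximalIdeal S) :=
    (isSimpleModule_iff_isCoatom).mpr (Ideal.isMaximal_def.mp (maximalIdeal.isMaximal S))
  calc Module.length S (MSections π (idealQuot (unitModule X) J) ⊤)
      ≤ Module.length S (S ⧸ maximalIdeal S) := Module.length_le_of_surjective φ hφ
    _ = 1 := Module.length_eq_one S (S ⧸ maximalIdeal S)

end LengthBound

end Summit.ResolutionOfSingularities.ResolutionOfSingularities.Theorems.NoZeno.QuadraticTransform

end
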